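import Summits.KontsevichZagierPeriods.KontsevichZagierPeriods.Theorems.MultiplicationAccessible.Negative.Variants

/-!
# Crux `MultiplicationAccessible` (stmt-KontsevichZagierPeriods-12305) — negative knowledge, part 3: the first rung is one move

Landed copy of §8 of `Cruxes/MultiplicationAccessible/Disproof.lean` (crux disprover, gen 1).
`boxRepOneOne_sub_simplexRepOneOne_mem_changeOfVariablesRel`: at `(m, s) = (1, 1)` the pair
`[(0,1), x^{−1/2}] − [(0,2), 1]` is ONE instance of Kontsevich–Zagier's rule (2) along `σ = 2√x`
(graph `σ² = 4x`, `|dσ/dx| = x^{−1/2}`; semialgebraicity, differentiability within the box,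
injectivity, image and Jacobian identity all discharged). Hence `at_one_one : At 1 1` — the crux
HOLDS at its first rung — and, with `not_byAdditivity` (part 2), the sub-calculus picture at the
first rung is complete: rule (2) alone suffices, rule (1) alone fails; no `coeffSum`-type
"additivity is necessary" obstruction exists for the family.

Reference: M. Kontsevich, D. Zagier, *Periods* (2001), §1.2 rule (2).
-/

noncomputable section

open MeasureTheory Set
open Literature.NumberTheory.Transcendental
open Literature.NumberTheory.Transcendental.KZ

namespace Summit.KontsevichZagierPeriods.MultiplicationAccessible.Negative

/-! ## §8 Positive calibration: the first rung `(1, 1)` is ONE change of variables -/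

section OneMove

open Literature.ModelTheory.ExponentialFields (IsSemialgebraic)
open MvPolynomial (X C aeval)

/-- The substitution `σ = 2√x` on `ℝ¹`. [folklore] -/
def sqrtMap (x : Fin 1 → ℝ) : Fin 1 → ℝ := fun _ => 2 * Real.sqrt (x 0)

/-- Its derivative at `x` (for `x 0 > 0`): `v ↦ (√(x 0))⁻¹ • v`. [folklore] -/
def sqrtMapDeriv (x : Fin 1 → ℝ) : (Fin 1 → ℝ) →L[ℝ] (Fin 1 → ℝ) :=
  (Real.sqrt (x 0))⁻¹ • ContinuousLinearMap.id ℝ (Fin 1 → ℝ)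

/-- Coordinates of `Fin.append` on `ℝ¹ × ℝ¹`. [folklore] -/
theorem append_fin_one_apply_zero (x y : Fin 1 → ℝ) : Fin.append x y 0 = x 0 :=
  Fin.append_left x y 0

/-- Coordinates of `Fin.append` on `ℝ¹ × ℝ¹`. [folklore] -/
theorem append_fin_one_apply_one (x y : Fin 1 → ℝ) : Fin.append x y 1 = y 0 :=
  Fin.append_right x y 0

/-- The graph of `σ = 2√x` over the box is cut out by `0 < x < 1`, `σ > 0`, `σ² − 4x = 0`. [folklore] -/
theorem graph_sqrtMap_eq :
    {z : Fin (1 + 1) → ℝ | ∃ x ∈ boxDom 1, z = Fin.append x (sqrtMap x)} =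
      {z | 0 < z 0 ∧ z 0 < 1 ∧ 0 < z 1 ∧ z 1 ^ 2 - 4 * z 0 = 0} := by
  ext z
  simp only [mem_setOf_eq]
  constructor
  · rintro ⟨x, hx, rfl⟩
    have hx0 : 0 < x 0 ∧ x 0 < 1 := hx 0
    rw [append_fin_one_apply_zero, append_fin_one_apply_one]
    refine ⟨hx0.1, hx0.2, mul_pos two_pos (Real.sqrt_pos.mpr hx0.1), ?_⟩
    simp only [sqrtMap, mul_pow, Real.sq_sqrt hx0.1.le]
    ring
  · rintro ⟨h0, h1, h2, h3⟩
    refine ⟨fun _ => z 0, fun _ => ⟨h0, h1⟩, ?_⟩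
    have hs : Real.sqrt (z 0) = z 1 / 2 := by
      rw [Real.sqrt_eq_iff_eq_sq h0.le (by positivity)]
      nlinarith
    funext i
    fin_cases i
    · exact (append_fin_one_apply_zero (fun _ => z 0) (sqrtMap fun _ => z 0)).symm
    · change z 1 = Fin.append (fun _ => z 0) (sqrtMap fun _ => z 0) 1
      rw [append_fin_one_apply_one]
      simp only [sqrtMap, hs]
      ring

/-- `σ = 2√x` is a `ℚ`-semialgebraic map on the box. [folklore] -/
theorem isSemialgebraicMapOn_sqrtMap : IsSemialgebraicMapOn ℚ (boxDom 1) sqrtMap := by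
  unfold IsSemialgebraicMapOn
  rw [graph_sqrtMap_eq]
  have h0 := Literature.ModelTheory.ExponentialFields.isSemialgebraic_setOf_eval_pos (k := ℚ)
    (R := ℝ) (X 0 : MvPolynomial (Fin (1 + 1)) ℚ)
  have h1 := Literature.ModelTheory.ExponentialFields.isSemialgebraic_setOf_eval_pos (k := ℚ)
    (R := ℝ) (1 - X 0 : MvPolynomial (Fin (1 + 1)) ℚ)
  have h2 := Literature.ModelTheory.ExponentialFields.isSemialgebraic_setOf_eval_pos (k := ℚ)
    (R := ℝ) (X 1 : MvPolynomial (Fin (1 + 1)) ℚ)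
  have h3 := Literature.ModelTheory.ExponentialFields.isSemialgebraic_setOf_eval_eq_zero (k := ℚ)
    (R := ℝ) (X 1 ^ 2 - C 4 * X 0 : MvPolynomial (Fin (1 + 1)) ℚ)
  simp only [MvPolynomial.aeval_X, map_sub, map_one, map_mul, map_pow, MvPolynomial.aeval_C,
    eq_ratCast, sub_pos] at h0 h1 h2 h3
  convert ((h0.inter h1).inter h2).inter h3 using 1
  ext z
  simp only [mem_setOf_eq, mem_inter_iff]
  push_cast
  tauto

/-- `σ = 2√x` has derivative `sqrtMapDeriv x` at every point of the box. [folklore] -/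
theorem hasFDerivAt_sqrtMap {x : Fin 1 → ℝ} (hx : 0 < x 0) :
    HasFDerivAt sqrtMap (sqrtMapDeriv x) x := by
  have h1 : HasFDerivAt (fun y : Fin 1 → ℝ => y 0) (ContinuousLinearMap.proj 0) x :=
    hasFDerivAt_apply (𝕜 := ℝ) 0 x
  have h2 : HasDerivAt (fun t : ℝ => 2 * Real.sqrt t) (2 * (1 / (2 * Real.sqrt (x 0)))) (x 0) :=
    (Real.hasDerivAt_sqrt hx.ne').const_mul 2
  have h3 := h2.hasFDerivAt.comp x h1
  refine hasFDerivAt_pi'' fun i => ?_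
  have hL : (ContinuousLinearMap.proj i).comp (sqrtMapDeriv x) =
      (ContinuousLinearMap.toSpanSingleton ℝ (2 * (1 / (2 * Real.sqrt (x 0))))).comp
        (ContinuousLinearMap.proj 0) := by
    refine ContinuousLinearMap.ext fun v => ?_
    have hs : Real.sqrt (x 0) ≠ 0 := (Real.sqrt_pos.mpr hx).ne'
    rw [Subsingleton.elim i 0]
    simp only [sqrtMapDeriv, ContinuousLinearMap.coe_comp, Function.comp_apply,
      FunLike.coe_smul, Pi.smul_apply, ContinuousLinearMap.coe_id', id_eq,
      smul_eq_mul, ContinuousLinearMap.proj_apply, ContinuousLinearMap.toSpanSingleton_apply]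
    field_simp
  rw [hL]
  exact h3

/-- The Jacobian determinant of `σ = 2√x` is `(√x)⁻¹`. [folklore] -/
theorem det_sqrtMapDeriv (x : Fin 1 → ℝ) : (sqrtMapDeriv x).det = (Real.sqrt (x 0))⁻¹ := by
  have h : ((sqrtMapDeriv x : (Fin 1 → ℝ) →L[ℝ] (Fin 1 → ℝ)) : (Fin 1 → ℝ) →ₗ[ℝ] (Fin 1 → ℝ)) =
      (Real.sqrt (x 0))⁻¹ • LinearMap.id := by
    refine LinearMap.ext fun v => funext fun i => ?_
    simp [sqrtMapDeriv]
  change LinearMap.det ((sqrtMapDeriv x : (Fin 1 → ℝ) →L[ℝ] (Fin 1 → ℝ)) :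
    (Fin 1 → ℝ) →ₗ[ℝ] (Fin 1 → ℝ)) = _
  rw [h, LinearMap.det_smul, LinearMap.det_id, Module.finrank_fin_fun]
  simp

/-- **The `(1, 1)` rung is a single rule-(2) move**: `[(0,1), x^{−1/2}] − [(0,2), 1] ∈
changeOfVariablesRel` along `σ = 2√x` (`|dσ/dx| = x^{−1/2}`). So the sub-calculus of rules
(2)+(3) suffices here — "additivity is necessary" is NOT a property of the family (contrast
`not_byAdditivity`). [cite: KontsevichZagier2001, §1.2 rule (2)] -/
theorem boxRepOneOne_sub_simplexRepOneOne_mem_changeOfVariablesRel :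
    of boxRepOneOne - of simplexRepOneOne ∈ changeOfVariablesRel := by
  refine ⟨1, boxRepOneOne, simplexRepOneOne, sqrtMap, sqrtMapDeriv, isSemialgebraicMapOn_sqrtMap,
    fun x hx => (hasFDerivAt_sqrtMap (hx 0).1).hasFDerivWithinAt, ?_, ?_, ?_, rfl⟩
  · -- injectivity
    intro x hx y hy hxy
    have hx0 : 0 < x 0 := (hx 0).1
    have hy0 : 0 < y 0 := (hy 0).1
    have h := congrFun hxy 0
    simp only [sqrtMap, mul_eq_mul_left_iff, OfNat.ofNat_ne_zero, or_false] at h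
    have h' : x 0 = y 0 := by
      have := congrArg (fun t => t ^ 2) h
      simpa [Real.sq_sqrt hx0.le, Real.sq_sqrt hy0.le] using this
    funext i
    rw [Subsingleton.elim i 0]
    exact h'
  · -- image
    change simplexDom 1 = sqrtMap '' boxDom 1
    ext y
    simp only [simplexDom, Nat.cast_one, mem_setOf_eq, mem_image, Fin.forall_fin_one,
      Fin.sum_univ_one]
    constructor
    · rintro ⟨hy0, hy2⟩
      refine ⟨fun _ => (y 0 / 2) ^ 2, fun _ => ⟨by positivity, ?_⟩, ?_⟩
      · have : y 0 / 2 < 1 := by linarith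
        have h0 : 0 ≤ y 0 / 2 := by positivity
        nlinarith
      · funext i
        rw [Subsingleton.elim i 0]
        simp only [sqrtMap]
        rw [Real.sqrt_sq (by positivity)]
        ring
    · rintro ⟨x, hx, rfl⟩
      have hx0 := hx 0
      simp only [sqrtMap]
      refine ⟨by have := Real.sqrt_pos.mpr hx0.1; positivity, ?_⟩
      have : Real.sqrt (x 0) < 1 := by
        rw [← Real.sqrt_one]
        exact Real.sqrt_lt_sqrt hx0.1.le hx0.2
      linarith
  · -- integrand identity `x^{-1/2} = 1 · |det|`
    intro x hx
    have hx0 : 0 < x 0 := (hx 0).1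
    rw [det_sqrtMapDeriv, abs_of_pos (inv_pos.mpr (Real.sqrt_pos.mpr hx0))]
    change (x 0) ^ ((((-1) / 2 : ℚ) : ℝ)) = ((1 : ℚ) : ℝ) * (Real.sqrt (x 0))⁻¹
    rw [Real.sqrt_eq_rpow, ← Real.rpow_neg hx0.le]
    push_cast
    norm_num

/-- **The crux holds at `(1, 1)`** (by one move). [folklore] -/
theorem at_one_one : At 1 1 :=
  (at_iff_of_witnesses isBoxRep_boxRepOneOne isSimplexRep_simplexRepOneOne).mpr
    (changeOfVariablesRel_subset_relations boxRepOneOne_sub_simplexRepOneOne_mem_changeOfVariablesRel)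

end OneMove

end Summit.KontsevichZagierPeriods.MultiplicationAccessible.Negative
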